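import Summits.HodgeConjecture.CorCM.MultiFieldWeilDihedralFive
import HarnessLib

/-!
# MULTI-FIELD WEIL ENGINE — THE COMMUTANT NO-GO: a relation between the centred indicators over the COMMUTANT of the slot image solves the signed equations
# non-trivially (any image); over a CYCLIC slot no two classes separate; over the DIHEDRAL pentagon the pairs with a common axis do not (census level)

Cell `pub-hodgecm2` (COR-CM), seat b30 gen 42 (2026-08-26); count-neutral own lane MULTI-FIELD WEIL ENGINE (stem `MultiFieldWeil*`), census level, the NEGATIVE companion
of `CorCM/MultiFieldWeilDihedralFive.lean` and the common generalisation of `CorCM/MultiFieldWeilUnitSeparationSharp.lean` (G8: over a `2`-transitive image a `ℚ`-dependency of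
the centred indicators is a non-constant solution) and `CorCM/MultiFieldWeilImprimitiveNoSeparation.lean` (G9: pairings).  Theorems only; no definition, no named fact, no `sorry`.
HONEST FRAMING: pure finite combinatorics; `HC_CM` is NOT touched.

THE PRINCIPLE (`signed_eq_zero_of_kernel_relation`, any `k`, ANY set `H ⊆ Sym(k)`).  Let `G_i : Fin k × Fin k → ℤ` be kernels INVARIANT under `H`
(`G_i(σ a, σ b) = G_i(a, b)`, i.e. commuting with the permutation action) with zero row sums, and suppose the RELATION `Σ_i Σ_b G_i(a, b) c_i(b) = 0` between the centred
indicators `c_i = k·𝟙_{Q_i} − |Q_i|`.  Then for every `v : Fin k → ℤ` the defects `u_i(a) = Σ_b G_i(b, a) v(b)` (the transposed kernels applied to `v`) solve the signed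
equations `Σ_i Σ_a ±_{σ a ∈ Q_i} u_i(a) = 0` for every `σ ∈ H`: `Σ_i ⟨c_i ∘ σ, u_i⟩ = ⟨Σ_i (G_i c_i) ∘ σ, v⟩ = 0`.  Representation-theoretically: separation of the `Q_i` is
EQUIVALENT to independence of the `c_i` over the commutant `End_H(V₀)` of the mass-zero permutation module (the positive half for `D₅` is `const_of_signed_dihedral_five`;
for `2`-transitive `H` the commutant is `ℚ` and this is U1 ∕ G8).  Two readings:
* §2 **THE CYCLIC `k`-GON** (`exists_nonconst_signed_of_rotations`): if every element of `H` is a rotation `x ↦ x + t` of `ℤ/k`, then for ANY two position sets `Q₁, Q₂` with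
  `Q₂` proper and non-empty the signed equations have a solution with `u₁` NOT constant (kernels = convolution by `c₂` and by `−c₁`: the commutant contains the whole group
  algebra `ℚ[ℤ/k]`, which is commutative).  READING: over a CM field `K ∋ k` whose `τ`-embeddings are permuted CYCLICALLY by `Aut(ℂ/k)` (e.g. `K/k` cyclic: `C₃`-sextics,
  `C₅`-decics) the units method yields ONE class and never two — two `(1,2)`-threefolds over a cyclic sextic field, two `(2,3)`-fivefolds over a `C₅`-decic field carry Hodge
  classes on their products outside the span of the transported Weil classes.
* §3 **THE DIHEDRAL PENTAGON, NEGATIVE HALF** (`two_centred_edge_add_eq`, `exists_nonconst_signed_of_dihedral_common_axis`): for every vertex `v` of `ℤ/5` the diagonal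
  `D = {v+1, v+4}` and the edge `E = {v+2, v+3}` (the two `2`-sets with axis through `v`) satisfy `2 c_E + 3 c_D + A c_D = 0` (`A c(s) = c(s+1) + c(s−1) − c(s+2) − c(s−2)`), so
  over any `H` inside `D₅ = {x ↦ x + t, x ↦ t − x}` their signed equations have a solution with `u_E` not constant.  With `CorCM/MultiFieldWeilDihedralFiveCriterion.lean`
  (`fIndependent_pairs_of_sum_ne`) this is SHARP: two distinct `2`-subsets of the pentagon separate over `D₅` iff their axes differ (`40` of the `45` unordered pairs).
[cite: Serre1977, §2.3 Ex. 2.6; §5.3] [cite: DixonMortimer1996, §1.4 Ex. 1.4.1–1.4.2; §2.1] [cite: Lang2002, XIII §4; XVII §1 (Schur, double centraliser)]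

## References
* [Serre1977] J.-P. Serre, *Linear Representations of Finite Groups*, GTM 42, §2.3 Ex. 2.6, §5.3.
* [DixonMortimer1996] J. D. Dixon, B. Mortimer, *Permutation Groups*, GTM 163, §1.4 Ex. 1.4.1–1.4.2, §2.1.
* [Lang2002] S. Lang, *Algebra*, GTM 211, XIII §4, XVII §1.
-/

noncomputable section

namespace Summit.HodgeConjecture.CorCM.MultiFieldWeil

open Finset
open Fin.CommRing

open scoped Classical

/-! ## §1 The principle: an invariant-kernel relation between the centred indicators solves the signed equations -/

section Principle

variable {k : ℕ} {ι : Type} [Fintype ι] {H : Finset (Equiv.Perm (Fin k))}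

/-- **THE COMMUTANT PRINCIPLE.**  `H ⊆ Sym(k)` arbitrary; kernels `G_i` invariant under `H` (`G_i(σ a, σ b) = G_i(a, b)`) with zero row sums; the relation
`Σ_i Σ_b G_i(a, b)·(k·[b ∈ Q_i] − |Q_i|) = 0` for every `a`.  Then for every `v` the defects `u_i(a) = Σ_b G_i(b, a) v(b)` solve `Σ_i Σ_a ±_{σ a ∈ Q_i} u_i(a) = 0` for every
`σ ∈ H`. [cite: Serre1977, §2.3 Ex. 2.6] [cite: Lang2002, XVII §1] -/
theorem signed_eq_zero_of_kernel_relation (Q : ι → Finset (Fin k)) (G : ι → Fin k → Fin k → ℤ)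
    (hG : ∀ σ ∈ H, ∀ i a b, G i (σ a) (σ b) = G i a b) (hG0 : ∀ i b, ∑ a, G i b a = 0)
    (hrel : ∀ a, ∑ i, ∑ b, G i a b * ((k : ℤ) * (if b ∈ Q i then 1 else 0) - (Q i).card) = 0)
    (v : Fin k → ℤ) (σ : Equiv.Perm (Fin k)) (hσ : σ ∈ H) :
    (∑ i, ∑ a, if σ a ∈ Q i then (∑ b, G i b a * v b) else -(∑ b, G i b a * v b)) = 0 := by
  set u : ι → Fin k → ℤ := fun i a => ∑ b, G i b a * v b with hu
  show (∑ i, ∑ a, if σ a ∈ Q i then u i a else -u i a) = 0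
  set c : ι → Fin k → ℤ := fun i a => (k : ℤ) * (if a ∈ Q i then 1 else 0) - (Q i).card with hc
  -- mass zero
  have hS : ∀ i, ∑ a, u i a = 0 := fun i => by
    simp only [hu]
    rw [Finset.sum_comm]
    refine Finset.sum_eq_zero fun b _ => ?_
    rw [← Finset.sum_mul, hG0 i b, zero_mul]
  -- the pairing with the moved centred indicators vanishes
  have hpair : ∑ i, ∑ a, c i (σ a) * u i a = 0 := by
    have hre : ∀ i, ∑ a, c i (σ a) * u i a = ∑ b, v b * ∑ a, G i (σ b) a * c i a := fun i => by
      calc ∑ a, c i (σ a) * u i a = ∑ a, ∑ b, v b * (G i b a * c i (σ a)) := by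
            refine Finset.sum_congr rfl fun a _ => ?_
            simp only [hu]
            rw [Finset.mul_sum]
            exact Finset.sum_congr rfl fun b _ => by ring
        _ = ∑ b, ∑ a, v b * (G i b a * c i (σ a)) := Finset.sum_comm
        _ = ∑ b, v b * ∑ a, G i b a * c i (σ a) := by simp only [Finset.mul_sum]
        _ = ∑ b, v b * ∑ a, G i (σ b) a * c i a := by
            refine Finset.sum_congr rfl fun b _ => ?_
            congr 1
            rw [← Equiv.sum_comp σ (fun a => G i (σ b) a * c i a)]
            exact Finset.sum_congr rfl fun a _ => by rw [hG σ hσ i b a]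
    rw [Finset.sum_congr rfl fun i _ => hre i, Finset.sum_comm]
    refine Finset.sum_eq_zero fun b _ => ?_
    rw [← Finset.mul_sum, hrel (σ b), mul_zero]
  -- the signed sum is `(2/k)·pairing + Σ_i (2|Q_i|/k − 1) S_i`
  have hite : ∀ i a, (if σ a ∈ Q i then u i a else -u i a) = (2 * (if σ a ∈ Q i then (1 : ℤ) else 0) - 1) * u i a := fun i a => by
    split_ifs <;> ring
  have hk : (k : ℤ) * ∑ i, ∑ a, (if σ a ∈ Q i then u i a else -u i a) =
      2 * ∑ i, ∑ a, c i (σ a) * u i a + ∑ i, (2 * ((Q i).card : ℤ) - k) * ∑ a, u i a := by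
    rw [Finset.mul_sum, Finset.mul_sum, ← Finset.sum_add_distrib]
    refine Finset.sum_congr rfl fun i _ => ?_
    rw [Finset.mul_sum, Finset.mul_sum, Finset.mul_sum, ← Finset.sum_add_distrib]
    refine Finset.sum_congr rfl fun a _ => ?_
    rw [hite, hc]
    ring
  have hz : ∑ i, (2 * ((Q i).card : ℤ) - k) * ∑ a, u i a = 0 := Finset.sum_eq_zero fun i _ => by rw [hS i, mul_zero]
  rw [hpair, mul_zero, zero_add, hz] at hk
  rcases Nat.eq_zero_or_pos k with hk0 | hk0
  · subst hk0
    exact Finset.sum_eq_zero fun i _ => Finset.sum_eq_zero fun a _ => a.elim0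
  · have hk' : (k : ℤ) ≠ 0 := by exact_mod_cast hk0.ne'
    exact (mul_eq_zero.1 hk).resolve_left hk'

end Principle

/-! ## §2 The cyclic `k`-gon: no two classes -/

section Cyclic

variable {k : ℕ} [NeZero k] {H : Finset (Equiv.Perm (Fin k))}

/-- **NO TWO CLASSES OVER A CYCLIC SLOT.**  If every `σ ∈ H` is a rotation `x ↦ x + t` of `ℤ/k`, then for any position sets `Q₁ = Q i₁`, `Q₂ = Q i₂` (`i₁ ≠ i₂`) with `Q₂`
proper and non-empty there are integer defects, `u_{i₁}` NOT constant, whose total signed sum vanishes at every `σ ∈ H` (kernels: convolution by `c_{i₂}` at `i₁`, by `−c_{i₁}`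
at `i₂`, `0` elsewhere; the relation is commutativity of convolution on `ℤ/k`). [cite: Serre1977, §2.3 Ex. 2.6] [cite: Lang2002, XVII §1] -/
theorem exists_nonconst_signed_of_rotations {ι : Type} [Fintype ι] [DecidableEq ι] (hH : ∀ σ ∈ H, ∃ t : Fin k, ∀ x, σ x = x + t)
    (Q : ι → Finset (Fin k)) {i₁ i₂ : ι} (hi : i₁ ≠ i₂) (h0 : (Q i₂).Nonempty) (hk : Q i₂ ≠ Finset.univ) :
    ∃ u : ι → Fin k → ℤ, (∃ a b, u i₁ a ≠ u i₁ b) ∧ ∀ σ ∈ H, (∑ i, ∑ a, if σ a ∈ Q i then u i a else -u i a) = 0 := by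
  -- centred indicators
  set c : ι → Fin k → ℤ := fun i b => (k : ℤ) * (if b ∈ Q i then 1 else 0) - (Q i).card with hc
  have hc0 : ∀ i, ∑ b, c i b = 0 := fun i => by
    simp only [hc, Finset.sum_sub_distrib, ← Finset.mul_sum, Finset.sum_boole, Finset.sum_const, Finset.card_univ, Fintype.card_fin,
      nsmul_eq_mul]
    simp
  -- kernels
  set G : ι → Fin k → Fin k → ℤ := fun i a b => if i = i₁ then c i₂ (a - b) else if i = i₂ then -c i₁ (a - b) else 0 with hG
  have hGinv : ∀ σ ∈ H, ∀ i a b, G i (σ a) (σ b) = G i a b := by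
    intro σ hσ i a b
    obtain ⟨t, ht⟩ := hH σ hσ
    simp only [hG, ht, add_sub_add_right_eq_sub]
  have hG0 : ∀ i b, ∑ a, G i b a = 0 := by
    intro i b
    have hsub : ∀ j, ∑ a, c j (b - a) = 0 := fun j => by
      rw [Fintype.sum_equiv (Equiv.subLeft b) (fun a => c j (b - a)) (c j) fun _ => rfl]; exact hc0 j
    by_cases h1 : i = i₁
    · simp only [hG, h1, if_true, hsub]
    · by_cases h2 : i = i₂
      · simp only [hG, h2, hi.symm, if_false, if_true, Finset.sum_neg_distrib, hsub, neg_zero]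
      · simp only [hG, h1, h2, if_false, Finset.sum_const_zero]
  have hrel : ∀ a, ∑ i, ∑ b, G i a b * ((k : ℤ) * (if b ∈ Q i then 1 else 0) - (Q i).card) = 0 := by
    intro a
    have hterm : ∀ i, ∑ b, G i a b * ((k : ℤ) * (if b ∈ Q i then 1 else 0) - (Q i).card) =
        if i = i₁ then ∑ b, c i₂ (a - b) * c i₁ b else if i = i₂ then -∑ b, c i₁ (a - b) * c i₂ b else 0 := fun i => by
      by_cases h1 : i = i₁
      · subst h1; simp only [hG, if_true, hc]
      · by_cases h2 : i = i₂
        · subst h2; simp only [hG, h1, if_false, if_true, hc, neg_mul, Finset.sum_neg_distrib]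
        · simp only [hG, h1, h2, if_false, zero_mul, Finset.sum_const_zero]
    rw [Finset.sum_congr rfl fun i _ => hterm i, Finset.sum_ite, Finset.sum_ite, Finset.sum_const_zero, add_zero]
    have hf1 : (Finset.univ.filter fun i => i = i₁) = {i₁} := by ext; simp
    have hf2 : ((Finset.univ.filter fun i => ¬ i = i₁).filter fun i => i = i₂) = {i₂} := by
      ext j; simp only [Finset.mem_filter, Finset.mem_univ, true_and, Finset.mem_singleton]
      exact ⟨fun h => h.2, fun h => ⟨by rw [h]; exact hi.symm, h⟩⟩
    rw [hf1, hf2, Finset.sum_singleton, Finset.sum_singleton]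
    -- commutativity of convolution: substitute `b ↦ a − b`
    have hcomm : ∑ b, c i₁ (a - b) * c i₂ b = ∑ b, c i₂ (a - b) * c i₁ b := by
      rw [← Fintype.sum_equiv (Equiv.subLeft a) (fun b => c i₂ (a - b) * c i₁ b) (fun b => c i₁ (a - b) * c i₂ b) fun b => by
        show c i₂ (a - b) * c i₁ b = c i₁ (a - (a - b)) * c i₂ (a - b)
        rw [sub_sub_cancel, mul_comm]]
    rw [hcomm, add_neg_cancel]
  -- the solution `u_i(a) = Σ_b G_i(b, a) δ₀(b) = G_i(0, a)`
  refine ⟨fun i a => ∑ b, G i b a * (if b = 0 then 1 else 0), ?_, fun σ hσ => signed_eq_zero_of_kernel_relation Q G hGinv hG0 hrel _ σ hσ⟩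
  have hval : ∀ a, (∑ b, G i₁ b a * (if b = 0 then (1 : ℤ) else 0)) = c i₂ (-a) := fun a => by
    rw [Finset.sum_eq_single (0 : Fin k) (fun b _ hb => by rw [if_neg hb, mul_zero]) (fun h => absurd (Finset.mem_univ _) h)]
    simp only [hG, if_true, mul_one, zero_sub]
  -- `c_{i₂}` is not constant
  obtain ⟨x, hx⟩ := h0
  obtain ⟨y, hy⟩ : ∃ y, y ∉ Q i₂ := by
    by_contra h
    push Not at h
    exact hk (Finset.eq_univ_iff_forall.2 h)
  refine ⟨-x, -y, ?_⟩
  show (∑ b, G i₁ b (-x) * (if b = 0 then (1 : ℤ) else 0)) ≠ ∑ b, G i₁ b (-y) * (if b = 0 then (1 : ℤ) else 0)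
  rw [hval, hval, neg_neg, neg_neg]
  simp only [hc, if_pos hx, if_neg hy]
  have : (0 : ℤ) < k := by exact_mod_cast Nat.pos_of_ne_zero (NeZero.ne k)
  linarith

end Cyclic

/-! ## §3 The dihedral pentagon, negative half: two `2`-sets with a common axis -/

section DihedralFive

/-- **THE COMMON-AXIS RELATION.**  For every vertex `v` of the pentagon `ℤ/5`, the centred indicators `c_D`, `c_E` of the diagonal `D = {v+1, v+4}` and the edge `E = {v+2, v+3}`
(the two `2`-subsets with axis through `v`) satisfy `2 c_E + 3 c_D + A c_D = 0`, `A c(s) = c(s+1) + c(s−1) − c(s+2) − c(s−2)` — a relation over `ℚ[A] ≅ ℚ(√5)`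
(`ĉ_E / ĉ_D = −(3+√5)/2`). [cite: Serre1977, §5.3] -/
theorem two_centred_edge_add_eq (v : Fin 5) (cD cE : Fin 5 → ℤ)
    (hD : ∀ s, cD s = 5 * (if s ∈ ({v + 1, v + 4} : Finset (Fin 5)) then 1 else 0) - 2)
    (hE : ∀ s, cE s = 5 * (if s ∈ ({v + 2, v + 3} : Finset (Fin 5)) then 1 else 0) - 2) (s : Fin 5) :
    2 * cE s + 3 * cD s + (cD (s + 1) + cD (s - 1) - cD (s + 2) - cD (s - 2)) = 0 := by
  -- write `s = v + j` and evaluate at the five values of `j`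
  obtain ⟨j, rfl⟩ : ∃ j, s = v + j := ⟨s - v, by ring⟩
  have key : ∀ (j : Fin 5), 2 * cE (v + j) + 3 * cD (v + j) + (cD (v + (j + 1)) + cD (v + (j - 1)) - cD (v + (j + 2)) - cD (v + (j - 2))) = 0 := by
    have memD : ∀ i : Fin 5, (v + i ∈ ({v + 1, v + 4} : Finset (Fin 5))) ↔ (i = 1 ∨ i = 4) := fun i => by
      simp only [Finset.mem_insert, Finset.mem_singleton, add_right_inj]
    have memE : ∀ i : Fin 5, (v + i ∈ ({v + 2, v + 3} : Finset (Fin 5))) ↔ (i = 2 ∨ i = 3) := fun i => by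
      simp only [Finset.mem_insert, Finset.mem_singleton, add_right_inj]
    intro j
    simp only [hD, hE, memD, memE]
    fin_cases j <;> decide
  have e1 : v + j + 1 = v + (j + 1) := by ring
  have e2 : v + j - 1 = v + (j - 1) := by ring
  have e3 : v + j + 2 = v + (j + 2) := by ring
  have e4 : v + j - 2 = v + (j - 2) := by ring
  rw [e1, e2, e3, e4]
  exact key j

variable {H : Finset (Equiv.Perm (Fin 5))}

/-- **NO SEPARATION FOR TWO `2`-SETS WITH A COMMON AXIS OVER THE DIHEDRAL PENTAGON.**  If every `σ ∈ H` is a rotation `x ↦ x + t` or a reflection `x ↦ t − x` of `ℤ/5`, then for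
the diagonal `Q_{i₁} = {v+1, v+4}` and the edge `Q_{i₂} = {v+2, v+3}` through a common axis the signed equations have a solution with `u_{i₂}` NOT constant (kernels
`3(5δ − 1) + 5A` at `i₁`, `2(5δ − 1)` at `i₂`, from `two_centred_edge_add_eq`; `A(a, b) = [b − a = ±1] − [b − a = ±2]` is `D₅`-invariant).  With
`fIndependent_pairs_of_sum_ne` this is the complete list of failing pairs of distinct `2`-sets. [cite: Serre1977, §5.3] [cite: Lang2002, XVII §1] -/
theorem exists_nonconst_signed_of_dihedral_common_axis {ι : Type} [Fintype ι] [DecidableEq ι]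
    (hH : ∀ σ ∈ H, ∃ t : Fin 5, (∀ x, σ x = x + t) ∨ (∀ x, σ x = t - x))
    (Q : ι → Finset (Fin 5)) {i₁ i₂ : ι} (hi : i₁ ≠ i₂) (v : Fin 5) (h₁ : Q i₁ = {v + 1, v + 4}) (h₂ : Q i₂ = {v + 2, v + 3}) :
    ∃ u : ι → Fin 5 → ℤ, (∃ a b, u i₂ a ≠ u i₂ b) ∧ ∀ σ ∈ H, (∑ i, ∑ a, if σ a ∈ Q i then u i a else -u i a) = 0 := by
  -- the two kernels `I' = 5δ − 1` and `A`
  set I' : Fin 5 → Fin 5 → ℤ := fun a b => 5 * (if a = b then 1 else 0) - 1 with hI'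
  set A : Fin 5 → Fin 5 → ℤ := fun a b => (if b - a = 1 ∨ b - a = 4 then 1 else 0) - (if b - a = 2 ∨ b - a = 3 then 1 else 0) with hA
  set G : ι → Fin 5 → Fin 5 → ℤ := fun i a b => if i = i₁ then 3 * I' a b + 5 * A a b else if i = i₂ then 2 * I' a b else 0 with hG
  have hcard₁ : (Q i₁).card = 2 := by
    rw [h₁, Finset.card_pair]; intro h; have : (1 : Fin 5) = 4 := add_left_cancel h; exact absurd this (by decide)
  have hcard₂ : (Q i₂).card = 2 := by
    rw [h₂, Finset.card_pair]; intro h; have : (2 : Fin 5) = 3 := add_left_cancel h; exact absurd this (by decide)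
  -- invariance
  have hI'inv : ∀ (σ : Equiv.Perm (Fin 5)) a b, I' (σ a) (σ b) = I' a b := fun σ a b => by
    simp only [hI', σ.injective.eq_iff]
  have hAinv : ∀ σ ∈ H, ∀ a b, A (σ a) (σ b) = A a b := by
    intro σ hσ a b
    obtain ⟨t, ht | ht⟩ := hH σ hσ
    · simp only [hA, ht, add_sub_add_right_eq_sub]
    · have e : t - b - (t - a) = -(b - a) := by ring
      simp only [hA, ht, e]
      have h14 : (-(b - a) = 1 ∨ -(b - a) = 4) ↔ (b - a = 1 ∨ b - a = 4) := by
        constructor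
        · rintro (h | h)
          · right; linear_combination (-1 : Fin 5) * h - five_eq_zero_fin
          · left; linear_combination (-1 : Fin 5) * h - five_eq_zero_fin
        · rintro (h | h)
          · right; linear_combination (-1 : Fin 5) * h - five_eq_zero_fin
          · left; linear_combination (-1 : Fin 5) * h - five_eq_zero_fin
      have h23 : (-(b - a) = 2 ∨ -(b - a) = 3) ↔ (b - a = 2 ∨ b - a = 3) := by
        constructor
        · rintro (h | h)
          · right; linear_combination (-1 : Fin 5) * h - five_eq_zero_fin
          · left; linear_combination (-1 : Fin 5) * h - five_eq_zero_fin
        · rintro (h | h)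
          · right; linear_combination (-1 : Fin 5) * h - five_eq_zero_fin
          · left; linear_combination (-1 : Fin 5) * h - five_eq_zero_fin
      simp only [h14, h23]
  have hGinv : ∀ σ ∈ H, ∀ i a b, G i (σ a) (σ b) = G i a b := fun σ hσ i a b => by
    simp only [hG, hI'inv σ a b, hAinv σ hσ a b]
  -- zero row sums
  have hI'0 : ∀ b, ∑ a, I' b a = 0 := fun b => by
    simp only [hI', Finset.sum_sub_distrib, Finset.sum_const, Finset.card_univ, Fintype.card_fin]
    rw [← Finset.mul_sum, Finset.sum_ite_eq]; simp
  have hA0 : ∀ b, ∑ a, A b a = 0 := fun b => by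
    rw [← Equiv.sum_comp (Equiv.addRight b) (A b)]
    simp only [hA, Equiv.coe_addRight, add_sub_cancel_right, Fin.sum_univ_five]
    decide
  have hG0 : ∀ i b, ∑ a, G i b a = 0 := fun i b => by
    by_cases h1 : i = i₁
    · simp only [hG, h1, if_true, Finset.sum_add_distrib, ← Finset.mul_sum, hI'0, hA0, mul_zero, add_zero]
    · by_cases h2 : i = i₂
      · simp only [hG, h2, hi.symm, if_false, if_true, ← Finset.mul_sum, hI'0, mul_zero]
      · simp only [hG, h1, h2, if_false, Finset.sum_const_zero]
  -- the relation, from `two_centred_edge_add_eq` (times `5`: `I'` acts as `5` on mass-zero functions)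
  set c : ι → Fin 5 → ℤ := fun i b => 5 * (if b ∈ Q i then 1 else 0) - (Q i).card with hc
  have hcD : ∀ s, c i₁ s = 5 * (if s ∈ ({v + 1, v + 4} : Finset (Fin 5)) then 1 else 0) - 2 := fun s => by
    simp only [hc, hcard₁, Nat.cast_ofNat]; simp only [h₁]
  have hcE : ∀ s, c i₂ s = 5 * (if s ∈ ({v + 2, v + 3} : Finset (Fin 5)) then 1 else 0) - 2 := fun s => by
    simp only [hc, hcard₂, Nat.cast_ofNat]; simp only [h₂]
  have hc0 : ∀ i, ∑ b, c i b = 0 := fun i => by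
    simp only [hc, Finset.sum_sub_distrib, ← Finset.mul_sum, Finset.sum_boole, Finset.sum_const, Finset.card_univ, Fintype.card_fin, nsmul_eq_mul]
    simp
  have hI'act : ∀ i a, ∑ b, I' a b * c i b = 5 * c i a := fun i a => by
    have : ∀ b, I' a b * c i b = 5 * ((if a = b then 1 else 0) * c i b) - c i b := fun b => by simp only [hI']; ring
    rw [Finset.sum_congr rfl fun b _ => this b, Finset.sum_sub_distrib, ← Finset.mul_sum, hc0 i, sub_zero]
    congr 1
    simp only [ite_mul, one_mul, zero_mul, Finset.sum_ite_eq, Finset.mem_univ, if_true]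
  have hAact : ∀ i a, ∑ b, A a b * c i b = c i (a + 1) + c i (a - 1) - c i (a + 2) - c i (a - 2) := fun i a => by
    have hAv : ∀ j : Fin 5, A a (a + j) = (if j = 1 ∨ j = 4 then 1 else 0) - (if j = 2 ∨ j = 3 then 1 else 0) := fun j => by
      simp only [hA, add_sub_cancel_left]
    have hA0' : A a (a + 0) = 0 := by rw [hAv]; decide
    have hA1 : A a (a + 1) = 1 := by rw [hAv]; decide
    have hA2 : A a (a + 2) = -1 := by rw [hAv]; decide
    have hA3 : A a (a + 3) = -1 := by rw [hAv]; decide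
    have hA4 : A a (a + 4) = 1 := by rw [hAv]; decide
    have e0 : a + (0 : Fin 5) = a := add_zero _
    have e3 : a + (3 : Fin 5) = a - 2 := by linear_combination five_eq_zero_fin
    have e4 : a + (4 : Fin 5) = a - 1 := by linear_combination five_eq_zero_fin
    rw [← Equiv.sum_comp (Equiv.addLeft a) (fun b => A a b * c i b), Fin.sum_univ_five]
    simp only [Equiv.coe_addLeft]
    rw [hA0', hA1, hA2, hA3, hA4, e0, e3, e4]
    ring
  have hrel : ∀ a, ∑ i, ∑ b, G i a b * (((5 : ℕ) : ℤ) * (if b ∈ Q i then 1 else 0) - (Q i).card) = 0 := by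
    intro a
    simp only [Nat.cast_ofNat]
    have hterm : ∀ i, ∑ b, G i a b * ((5 : ℤ) * (if b ∈ Q i then 1 else 0) - (Q i).card) =
        if i = i₁ then 3 * (5 * c i₁ a) + 5 * (c i₁ (a + 1) + c i₁ (a - 1) - c i₁ (a + 2) - c i₁ (a - 2))
        else if i = i₂ then 2 * (5 * c i₂ a) else 0 := fun i => by
      by_cases hj1 : i = i₁
      · subst hj1
        simp only [hG, if_true]
        rw [← hI'act, ← hAact, Finset.mul_sum, Finset.mul_sum, ← Finset.sum_add_distrib]
        exact Finset.sum_congr rfl fun b _ => by simp only [hc]; ring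
      · by_cases hj2 : i = i₂
        · subst hj2
          simp only [hG, hj1, if_false, if_true]
          rw [← hI'act, Finset.mul_sum]
          exact Finset.sum_congr rfl fun b _ => by simp only [hc]; ring
        · simp only [hG, hj1, hj2, if_false, zero_mul, Finset.sum_const_zero]
    rw [Finset.sum_congr rfl fun i _ => hterm i, Finset.sum_ite, Finset.sum_ite, Finset.sum_const_zero, add_zero]
    have hf1 : (Finset.univ.filter fun i => i = i₁) = {i₁} := by ext; simp
    have hf2 : ((Finset.univ.filter fun i => ¬ i = i₁).filter fun i => i = i₂) = {i₂} := by
      ext j; simp only [Finset.mem_filter, Finset.mem_univ, true_and, Finset.mem_singleton]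
      exact ⟨fun h => h.2, fun h => ⟨by rw [h]; exact hi.symm, h⟩⟩
    rw [hf1, hf2, Finset.sum_singleton, Finset.sum_singleton]
    have := two_centred_edge_add_eq v (c i₁) (c i₂) hcD hcE a
    linear_combination 5 * this
  -- the solution from `v ↦ δ_v`-vector `δ₀`
  refine ⟨fun i a => ∑ b, G i b a * (if b = 0 then 1 else 0), ?_, fun σ hσ => signed_eq_zero_of_kernel_relation Q G hGinv hG0 hrel _ σ hσ⟩
  have hval : ∀ a, (∑ b, G i₂ b a * (if b = 0 then (1 : ℤ) else 0)) = 2 * I' 0 a := fun a => by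
    rw [Finset.sum_eq_single (0 : Fin 5) (fun b _ hb => by rw [if_neg hb, mul_zero]) (fun h => absurd (Finset.mem_univ _) h)]
    simp only [hG, hi.symm, if_false, if_true, mul_one]
  refine ⟨0, 1, ?_⟩
  show (∑ b, G i₂ b 0 * (if b = 0 then (1 : ℤ) else 0)) ≠ ∑ b, G i₂ b 1 * (if b = 0 then (1 : ℤ) else 0)
  rw [hval, hval]
  simp only [hI']
  decide

end DihedralFive

end Summit.HodgeConjecture.CorCM.MultiFieldWeil

end
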